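import Summits.QuantumFields.YangMills.Theorems.FluctuationComparisonRegPrIntLS2BetaTubularChartActLocalWinId
import Summits.QuantumFields.YangMills.Theorems.FluctuationComparisonRegPrIntLS2BetaTubularChartDockTransversal
import HarnessLib

/-!
# (C3β″-DOCK) TUBULAR HAAR COORDINATES DOCKED ON `pivotAct` — LOCAL EDITION WITH THE FREE-BOND WINDOW NAMED («WINDOW-ID», (Q-TUBE)(ii))

Crux `stmt-QuantumFields-20520` (`…Theses.UnitScaleTilt.FluctuationComparisonRegPrIntL`), LINE g18-1 S2β, organ (C3) ∕ DET-REP (B) (Q-TUBE)(ii); cell `ym3-torus`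
(HUMAN RULING D-0037 — rung R3, not Clay), width seat `ym3-torus-px21` g17 (lineage of ✓`…TubularChartDockLocal`); count-neutral helper
(`--kind proof --supports stmt-QuantumFields-20520 --as helper`).  Theorems only: 0 `def`, 0 `instance`, 0 `notation`, 0 `sorry`.
WHY.  ymfull-r3-prover-4 g0's (Q-TUBE) algebra ✓`…S2BetaSliceOfCombForm` displays WINDOW-ID `hWin : ∀ y, (∀ b, ‖(eV y)_b‖ < r) → y ∈ UV` for the tube of
record, which docks on ✓`exists_tubularHaarChart_pivotAct_local`; that letter exports `UV` only as SOME open window.  This twin re-runs it VERBATIM over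
✓`…TubularChartActLocalWinId.exists_tubularHaarChart_act_local_winId` and appends TWO conjuncts, last:
(F5) `UV = eV ⁻¹' B(0, s∕2)`, `s = IsChartRep.chartRadius (specialUnitaryLogChart (Fin 2))` (one-bond radius, DEPTH-UNIFORM; `s∕2 = ½·log(4∕3)`), and
(F6) COVER: a fine field `V'` whose BIG-comb axial readings relative to `U₀` off comb ∪ pivots lie in `Θ(B(0, s∕2))` IS
`pivotAct F hJK ι (w, c ↦ V'(ι c) U₀(ι c)⁻¹) (σ y)` for some `y ∈ UV`, with the residual factor NAMED: `↑w = (T_{V'})⁻¹ T_{U₀}` (`T = combTransporter (K−J)`).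
WHAT.  ★★★ `exists_tubularHaarChart_pivotAct_local_winId` = every row of ✓`exists_tubularHaarChart_pivotAct_local` VERBATIM (same binders, same order) +
(F5) + (F6) last; the parent's §1 helpers (`offPivot_transversal_of_rows`, `groupChart_rows_of_rooted`) are IMPORTED from the parent, not restated.
HONEST SCOPE.  A chart-side re-export; nothing of (Q-TUBE)∕DET-REP (B)∕LIMIT∕(CT)∕S2β∕crux 20520 is proved here; rung R3 — NOT d = 4, NOT infinite volume,
NOT a mass gap, NOT Clay.
[cite: Helgason2000, Ch. I §1 Thm 1.14 (13) p. 96; Balaban1985Averaging, (8), (10) p.18; Balaban1985Variational, Thm 1 (8)-(10) p.279; Balaban1985UV3, (18) p.260]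
-/

noncomputable section

open MeasureTheory MeasureTheory.Measure Filter Topology Set Function Metric
open scoped ENNReal Matrix.Norms.L2Operator
open Literature.MathematicalPhysics.QuantumFieldTheory.Balaban1983to89
open Literature.MathematicalPhysics.QuantumFieldTheory.Balaban1983to89.T3ContinuumYM3Torus
open Literature.MathematicalPhysics.QuantumFieldTheory.Balaban1983to89.HaarExponentialChart
open Literature.MathematicalPhysics.QuantumFieldTheory.Balaban1983to89.LogChartProduct
open Literature.MathematicalPhysics.QuantumFieldTheory.Balaban1983to89.T3UnitLawDensityEML
open Literature.MathematicalPhysics.QuantumFieldTheory.Balaban1983to89.T3TiltDescent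
open Literature.MathematicalPhysics.QuantumFieldTheory.Balaban1983to89.B15DeterminingSets (embIter)
open Literature.MathematicalPhysics.QuantumFieldTheory.Balaban1983to89.B12GaugeOrbits021 (IsResidual)
open scoped Literature.MathematicalPhysics.QuantumFieldTheory.Balaban1983to89.T3OrbitAverage
open Summit.QuantumFields.YangMills.Theorems.FluctuationComparisonRegPrIntLWregChain (iterCentralBond)
open Summit.QuantumFields.YangMills.Theorems.FluctuationComparisonRegPrIntLS2BetaResidualSubgroup
open Summit.QuantumFields.YangMills.Theorems.FluctuationComparisonRegPrIntLS2BetaResidualGaugeRooted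
open Summit.QuantumFields.YangMills.Theorems.FluctuationComparisonRegPrIntLS2BetaLaplaceInstGroupChart
open Summit.QuantumFields.YangMills.Theorems.FluctuationComparisonRegPrIntLS2BetaTubularChartActLocalWinId
open Literature.MathematicalPhysics.QuantumFieldTheory.Balaban1983to89.B13HaarSigmaJacobian (jac)
open Summit.QuantumFields.YangMills.Theorems.FluctuationComparisonRegPrIntLS2BetaTubularChartDockTransversal (offPivot_transversal_of_rows)
open Summit.QuantumFields.YangMills.Theorems.FluctuationComparisonRegPrIntLS2BetaSignedComb (combTransporter)
open Summit.QuantumFields.YangMills.Theorems.FluctuationComparisonRegPrIntLS2BetaSignedCombKill (combSet)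
open Summit.QuantumFields.YangMills.Theorems.FluctuationComparisonRegPrIntLS2BetaSignedCombLipschitz
open Summit.QuantumFields.YangMills.Theorems.FluctuationComparisonRegPrIntLS2BetaResidualGauge (residual_one)
open Summit.QuantumFields.YangMills.Theorems.FluctuationComparisonRegPrIntLS2BetaResidualGaugeCentral (exists_central_isResidual_of_residual)

namespace Summit.QuantumFields.YangMills.Theorems.FluctuationComparisonRegPrIntLS2BetaTubularChartDockLocalWinId

variable (F : T3Family) {J K : ℕ} (hJK : J ≤ K)

/-! ## The docked chart rows, local edition -/

set_option maxHeartbeats 400000 in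
/-- ★★★ **FREE-BOND WINDOW NAMED** — every row of ✓`…TubularChartDockLocal.exists_tubularHaarChart_pivotAct_local` VERBATIM plus the LAST two
conjuncts (F5) «WINDOW-ID» `UV = eV ⁻¹' ball 0 (IsChartRep.chartRadius (specialUnitaryLogChart (Fin 2)) ∕ 2)` (one-bond chart radius, depth-uniform) and
(F6) «COVER» (`V' = pivotAct F hJK ι (w, c ↦ V'(ι c) U₀(ι c)⁻¹) (σ y)`, `y ∈ UV`, `↑w = (T_{V'})⁻¹ T_{U₀}`, for every `V'` with big-comb axial readings
relative to `U₀` in `Θ(B(0, s∕2))` off comb ∪ pivots).  PARENT: ★★★ **THE (C3β″) CHART, DOCKED, LOCAL EDITION** — for `S := residualSubgroup F hJK`, `act := pivotAct F hJK (iterCentralBond (K − J))` and every base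
point `U₀`: the rows of ✓`…TubularChartDockTransversal.exists_tubularHaarChart_pivotAct_transversal` (group chart `e`, smooth continuous transversal `σ` through `U₀`,
(D0), (D1), (T2), `𝓝 (σ 0) ≤ map Θ (𝓝 0)`, injectivity, chart identity, radius `ρ`) with the window EXPORTED as a product `UZ ×ˢ UV` of open neighbourhoods of `0`
(F1), the density as a product `jZ z · jV y` of continuous nonnegative functions positive at `0` (F2, with `∀ᶠ y in 𝓝 0, 0 < jV y` and `0 < ∫_{ball 0 ρ} jZ`),
the tube map OPEN AT EVERY POINT of `UZ ×ˢ UV` (F3), the free-bond frame `eV` exported, (F4a) the bondwise formula of `σ` off comb ∪ pivots and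
(F4b′) `jV = σ₀·|det jac(eV ·)|`. [cite: Balaban1985Variational, Thm 1 (8)-(10) p.279, (19) p.281; Helgason2000, Ch. I §1 Thm 1.14 (13) p.96;
Balaban1985Averaging, (8), (10) p.18] -/
theorem exists_tubularHaarChart_pivotAct_local_winId (hk : K - J ≤ (F.P K).m + (F.P K).K)
    [DecidablePred (· ∈ (combSet (K - J) : Set (PBond (F.P K) 0)) ∪ Set.range (iterCentralBond (P := F.P K) (K - J)))] (dZ dV : ℕ)
    (hdZ : dZ = Module.finrank ℝ (specialUnitaryLogChart (Fin 2)).lie *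
      ((Fintype.card (Site (F.P K) 0) - Fintype.card (Site (F.P K) (K - J))) + Fintype.card (PBond (F.P K) (K - J))))
    (hdV : dV = Module.finrank ℝ (specialUnitaryLogChart (Fin 2)).lie *
        (Fintype.card (PBond (F.P K) 0) - Fintype.card (PBond (F.P K) (K - J))) -
      Module.finrank ℝ (specialUnitaryLogChart (Fin 2)).lie * (Fintype.card (Site (F.P K) 0) - Fintype.card (Site (F.P K) (K - J))))
    (U₀ : GaugeField (F.P K) 0 (Matrix.specialUnitaryGroup (Fin 2) ℂ)) :
    ∃ (e : EuclideanSpace ℝ (Fin dZ) → residualSubgroup F hJK × (PBond (F.P K) (K - J) → Matrix.specialUnitaryGroup (Fin 2) ℂ))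
      (σ : EuclideanSpace ℝ (Fin dV) → GaugeField (F.P K) 0 (Matrix.specialUnitaryGroup (Fin 2) ℂ))
      (eV : EuclideanSpace ℝ (Fin dV) ≃L[ℝ] (piLogChart (specialUnitaryLogChart (Fin 2)) {b : PBond (F.P K) 0 // b ∉ (combSet (K - J) : Set (PBond (F.P K) 0)) ∪ Set.range (iterCentralBond (P := F.P K) (K - J))}).lie)
      (UZ : Set (EuclideanSpace ℝ (Fin dZ))) (UV : Set (EuclideanSpace ℝ (Fin dV)))
      (jZ : EuclideanSpace ℝ (Fin dZ) → ℝ) (jV : EuclideanSpace ℝ (Fin dV) → ℝ) (ρ : ℝ),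
      Continuous e ∧ e 0 = 1 ∧
      𝓝 (1 : residualSubgroup F hJK × (PBond (F.P K) (K - J) → Matrix.specialUnitaryGroup (Fin 2) ℂ)) ≤ map e (𝓝 0) ∧
      Continuous σ ∧ σ 0 = U₀ ∧
      ContDiff ℝ ⊤ (fun y : EuclideanSpace ℝ (Fin dV) => fun b : PBond (F.P K) 0 =>
        ((σ y b : Matrix.specialUnitaryGroup (Fin 2) ℂ) : Matrix (Fin 2) (Fin 2) ℂ)) ∧
      (∀ y, ∀ b ∈ (combSet (K - J) : Set (PBond (F.P K) 0)) ∪ Set.range (iterCentralBond (P := F.P K) (K - J)), σ y b = U₀ b) ∧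
      (∀ y, combTransporter (K - J) (σ y) = combTransporter (K - J) U₀) ∧
      (∀ y (b : PBond (F.P K) 0) (hb : b ∉ (combSet (K - J) : Set (PBond (F.P K) 0)) ∪ Set.range (iterCentralBond (P := F.P K) (K - J))),
        σ y b = U₀ b * ((combTransporter (K - J) U₀ b.tgt)⁻¹ *
          (isChartRep_specialUnitaryGroup (n := Fin 2)).expChart
            (lieApply (specialUnitaryLogChart (Fin 2)) {b : PBond (F.P K) 0 // b ∉ (combSet (K - J) : Set (PBond (F.P K) 0)) ∪ Set.range (iterCentralBond (P := F.P K) (K - J))} (eV y) ⟨b, hb⟩) *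
          combTransporter (K - J) U₀ b.tgt)) ∧
      (∃ c₁ : ℝ, 0 < c₁ ∧ ∀ᶠ y in 𝓝 (0 : EuclideanSpace ℝ (Fin dV)),
        c₁ * ‖y‖ ^ 2 ≤ ⨅ w : {w : Site (F.P K) 0 → Matrix.specialUnitaryGroup (Fin 2) ℂ |
              ∀ U : GaugeField (F.P K) 0 (Matrix.specialUnitaryGroup (Fin 2) ℂ),
                descendTo F ℰp J K hJK (GaugeField.gaugeAct w U) = descendTo F ℰp J K hJK U},
            ∑ ℓ ∈ Finset.univ.filter (fun ℓ : PBond (F.P K) 0 => ∀ c, iterCentralBond (P := F.P K) (K - J) c ≠ ℓ),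
              dist1 (σ y ℓ * ((GaugeField.gaugeAct (w : Site (F.P K) 0 → Matrix.specialUnitaryGroup (Fin 2) ℂ) U₀) ℓ)⁻¹) ^ 2) ∧
      𝓝 (σ 0) ≤ map (fun p : EuclideanSpace ℝ (Fin dZ) × EuclideanSpace ℝ (Fin dV) =>
        pivotAct F hJK (iterCentralBond (P := F.P K) (K - J)) (e p.1) (σ p.2)) (𝓝 0) ∧
      IsOpen UZ ∧ IsOpen UV ∧ (0 : EuclideanSpace ℝ (Fin dZ)) ∈ UZ ∧ (0 : EuclideanSpace ℝ (Fin dV)) ∈ UV ∧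
      InjOn (fun p : EuclideanSpace ℝ (Fin dZ) × EuclideanSpace ℝ (Fin dV) =>
        pivotAct F hJK (iterCentralBond (P := F.P K) (K - J)) (e p.1) (σ p.2)) (UZ ×ˢ UV) ∧
      (∀ p ∈ UZ ×ˢ UV, ∀ s ∈ 𝓝 p, (fun p : EuclideanSpace ℝ (Fin dZ) × EuclideanSpace ℝ (Fin dV) =>
        pivotAct F hJK (iterCentralBond (P := F.P K) (K - J)) (e p.1) (σ p.2)) '' s ∈
        𝓝 ((fun p : EuclideanSpace ℝ (Fin dZ) × EuclideanSpace ℝ (Fin dV) =>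
        pivotAct F hJK (iterCentralBond (P := F.P K) (K - J)) (e p.1) (σ p.2)) p)) ∧
      Continuous jZ ∧ Continuous jV ∧ (∀ z, 0 ≤ jZ z) ∧ (∀ y, 0 ≤ jV y) ∧ 0 < jZ 0 ∧ 0 < jV 0 ∧
      (∀ᶠ y in 𝓝 (0 : EuclideanSpace ℝ (Fin dV)), 0 < jV y) ∧
      (∃ σ₀ : ℝ, 0 < σ₀ ∧ ∀ y, jV y = σ₀ * |LinearMap.det
        (jac (lie_adStable_pi (specialUnitaryLogChart (Fin 2)) {b : PBond (F.P K) 0 // b ∉ (combSet (K - J) : Set (PBond (F.P K) 0)) ∪ Set.range (iterCentralBond (P := F.P K) (K - J))}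
            (lie_adStable_specialUnitaryGroup (n := Fin 2))) (eV y) :
          (piLogChart (specialUnitaryLogChart (Fin 2)) {b : PBond (F.P K) 0 // b ∉ (combSet (K - J) : Set (PBond (F.P K) 0)) ∪ Set.range (iterCentralBond (P := F.P K) (K - J))}).lie →ₗ[ℝ]
          (piLogChart (specialUnitaryLogChart (Fin 2)) {b : PBond (F.P K) 0 // b ∉ (combSet (K - J) : Set (PBond (F.P K) 0)) ∪ Set.range (iterCentralBond (P := F.P K) (K - J))}).lie)|) ∧
      (fieldMeasure (F.P K) 0 (Matrix.specialUnitaryGroup (Fin 2) ℂ)).restrict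
          ((fun p : EuclideanSpace ℝ (Fin dZ) × EuclideanSpace ℝ (Fin dV) =>
        pivotAct F hJK (iterCentralBond (P := F.P K) (K - J)) (e p.1) (σ p.2)) '' (UZ ×ˢ UV)) =
        ((((volume : Measure (EuclideanSpace ℝ (Fin dZ))).prod (volume : Measure (EuclideanSpace ℝ (Fin dV)))).restrict (UZ ×ˢ UV)).withDensity
            fun w => ENNReal.ofReal (jZ w.1 * jV w.2)).map
          (fun p : EuclideanSpace ℝ (Fin dZ) × EuclideanSpace ℝ (Fin dV) =>
        pivotAct F hJK (iterCentralBond (P := F.P K) (K - J)) (e p.1) (σ p.2)) ∧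
      0 < ρ ∧ closedBall (0 : EuclideanSpace ℝ (Fin dZ)) ρ ⊆ UZ ∧
      0 < ∫ z in ball (0 : EuclideanSpace ℝ (Fin dZ)) ρ, jZ z ∧
      UV = eV ⁻¹' ball (0 : (piLogChart (specialUnitaryLogChart (Fin 2))
        {b : PBond (F.P K) 0 // b ∉ (combSet (K - J) : Set (PBond (F.P K) 0)) ∪ Set.range (iterCentralBond (P := F.P K) (K - J))}).lie)
        (IsChartRep.chartRadius (specialUnitaryLogChart (Fin 2)) / 2) ∧
      (∀ V' : GaugeField (F.P K) 0 (Matrix.specialUnitaryGroup (Fin 2) ℂ),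
        (∀ (b : PBond (F.P K) 0) (hb : b ∉ (combSet (K - J) : Set (PBond (F.P K) 0)) ∪ Set.range (iterCentralBond (P := F.P K) (K - J))),
          (combTransporter (K - J) U₀ b.src * U₀ b * (combTransporter (K - J) U₀ b.tgt)⁻¹)⁻¹ *
              (combTransporter (K - J) V' b.src * V' b * (combTransporter (K - J) V' b.tgt)⁻¹) ∈
            (isChartRep_specialUnitaryGroup (n := Fin 2)).window (IsChartRep.chartRadius (specialUnitaryLogChart (Fin 2)) / 2)) →
        ∃ y ∈ UV, ∃ w : residualSubgroup F hJK,
          (w : Site (F.P K) 0 → Matrix.specialUnitaryGroup (Fin 2) ℂ) = (fun x => (combTransporter (K - J) V' x)⁻¹ * combTransporter (K - J) U₀ x) ∧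
          V' = pivotAct F hJK (iterCentralBond (P := F.P K) (K - J))
            (w, fun c => V' (iterCentralBond (P := F.P K) (K - J) c) * (U₀ (iterCentralBond (P := F.P K) (K - J) c))⁻¹) (σ y)) := by
  classical
  obtain ⟨e, σ, eV, UZ, UV, jZ, jV, ρ₀, hec, he0, heres, hsurj, hσc, hσ0, hσs, hσF, hσT, hF4, hσgr, hUZo, hUVo, h0Z, h0V, hρ₀, hball, hinj,
      hopen, hF3, hjZc, hjVc, hjZ0, hjV0, hjZpos, hjVpos, hF4b, hchart, hF5, hF6⟩ :=
    exists_tubularHaarChart_act_local_winId (F.P K) hk dZ dV hdZ hdV U₀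
  -- lift `e` into the subgroup (rooted ⇒ residual, px11's GAP 4)
  set el : EuclideanSpace ℝ (Fin dZ) → residualSubgroup F hJK × (PBond (F.P K) (K - J) → Matrix.specialUnitaryGroup (Fin 2) ℂ) :=
    fun z => (⟨(e z).1, residual_of_isResidual F hJK (heres z)⟩, (e z).2) with hel
  -- the action of record through the lift IS the letter's tube map (definitionally)
  have hΘ : (fun p : EuclideanSpace ℝ (Fin dZ) × EuclideanSpace ℝ (Fin dV) =>
      pivotAct F hJK (iterCentralBond (P := F.P K) (K - J)) (el p.1) (σ p.2)) =
      fun p => Function.extend (iterCentralBond (P := F.P K) (K - J)) (fun c => (e p.1).2 c * σ p.2 (iterCentralBond (P := F.P K) (K - J) c))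
        (GaugeField.gaugeAct (e p.1).1 (σ p.2)) := by
    funext p; rfl
  -- shrink the radius so that `jZ > jZ(0)/2` on the ball
  have hJat : ContinuousAt jZ (0 : EuclideanSpace ℝ (Fin dZ)) := hjZc.continuousAt
  obtain ⟨δ, hδ, hδJ⟩ := Metric.continuousAt_iff.1 hJat (jZ 0 / 2) (by linarith)
  set ρ : ℝ := min ρ₀ (δ / 2) with hρ
  have hρpos : 0 < ρ := lt_min hρ₀ (by linarith)
  have hρle : ρ ≤ ρ₀ := min_le_left _ _
  have hρδ : ρ < δ := lt_of_le_of_lt (min_le_right _ _) (by linarith)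
  have hballW : closedBall (0 : EuclideanSpace ℝ (Fin dZ)) ρ ⊆ UZ := (Metric.closedBall_subset_closedBall hρle).trans hball
  -- lower bound `jZ z ≥ jZ 0 / 2` on the ball
  have hlow : ∀ z ∈ ball (0 : EuclideanSpace ℝ (Fin dZ)) ρ, jZ 0 / 2 ≤ jZ z := by
    intro z hz
    have hd : dist z (0 : EuclideanSpace ℝ (Fin dZ)) < δ := lt_trans (mem_ball.1 hz) hρδ
    have := hδJ hd
    rw [Real.dist_eq] at this
    have := (abs_lt.1 this).1
    linarith
  refine ⟨el, σ, eV, UZ, UV, jZ, jV, ρ, ?_, ?_, ?_, hσc, hσ0, hσs, hσF, hσT, hF4, ?_, ?_, hUZo, hUVo, h0Z, h0V, ?_, ?_,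
    hjZc, hjVc, hjZ0, hjV0, hjZpos, hjVpos, ?_, hF4b, ?_, hρpos, hballW, ?_, hF5, ?_⟩
  · -- `el` continuous (w5's packaged row)
    exact (groupChart_rows_of_rooted F hJK hec he0 heres hsurj).1
  · -- `el 0 = 1`
    exact (groupChart_rows_of_rooted F hJK hec he0 heres hsurj).2.1
  · -- `𝓝 1 ≤ map el (𝓝 0)`: near `1`, residual = rooted (w5's packaged row)
    exact (groupChart_rows_of_rooted F hJK hec he0 heres hsurj).2.2
  · -- (T2) OFF-PIVOT QUADRATIC TRANSVERSALITY OF THE TUBE: rows (A0)(A1)(A2) of the letter, by §1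
    exact offPivot_transversal_of_rows F hJK hk hσF hσT hσgr
  · -- `𝓝 (σ 0) ≤ map Θ (𝓝 0)`
    rw [hΘ, hσ0]
    exact Filter.le_map fun s hs => hopen s hs
  · -- injectivity on the window
    rw [hΘ]; exact hinj
  · -- (F3) openness at every point of the window
    rw [hΘ]; exact hF3
  · -- `jV > 0` near `0`
    exact hjVc.continuousAt.eventually (Ioi_mem_nhds hjVpos)
  · -- the chart identity
    rw [hΘ]; exact hchart
  · -- `0 < ∫_{ball 0 ρ} jZ`
    have hcontJ : ContinuousOn jZ (closedBall (0 : EuclideanSpace ℝ (Fin dZ)) ρ) := hjZc.continuousOn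
    have hint : IntegrableOn jZ (ball (0 : EuclideanSpace ℝ (Fin dZ)) ρ) volume :=
      (hcontJ.integrableOn_compact (isCompact_closedBall _ _)).mono_set ball_subset_closedBall
    have hvol : 0 < (volume (ball (0 : EuclideanSpace ℝ (Fin dZ)) ρ)).toReal :=
      ENNReal.toReal_pos (measure_ball_pos volume _ hρpos).ne' measure_ball_lt_top.ne
    have hconst : ∫ z in ball (0 : EuclideanSpace ℝ (Fin dZ)) ρ, jZ 0 / 2 = (volume (ball (0 : EuclideanSpace ℝ (Fin dZ)) ρ)).toReal * (jZ 0 / 2) := by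
      rw [setIntegral_const, smul_eq_mul]; rfl
    calc (0 : ℝ) < (volume (ball (0 : EuclideanSpace ℝ (Fin dZ)) ρ)).toReal * (jZ 0 / 2) := mul_pos hvol (by linarith)
      _ = ∫ z in ball (0 : EuclideanSpace ℝ (Fin dZ)) ρ, jZ 0 / 2 := hconst.symm
      _ ≤ ∫ z in ball (0 : EuclideanSpace ℝ (Fin dZ)) ρ, jZ z :=
          setIntegral_mono_on (integrableOn_const measure_ball_lt_top.ne) hint measurableSet_ball fun z hz => hlow z hz
  · -- (F6) THE COVER ROW, docked on `pivotAct`: the residual factor `(T_{V'})⁻¹ T_{U₀}` is root-trivial (`combTransporter_embIter`), hence residual (px11's GAP 4)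
    intro V' hV'
    obtain ⟨y, hy, hEq⟩ := hF6 V' hV'
    have hres : IsResidual (K - J) (fun x => (combTransporter (K - J) V' x)⁻¹ * combTransporter (K - J) U₀ x) := fun x => by
      simp only [FluctuationComparisonRegPrIntLS2BetaSignedComb.combTransporter_embIter hk, inv_one, mul_one]
    exact ⟨y, hy, ⟨_, residual_of_isResidual F hJK hres⟩, rfl, hEq⟩

end Summit.QuantumFields.YangMills.Theorems.FluctuationComparisonRegPrIntLS2BetaTubularChartDockLocalWinId

end
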